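import Summits.AtomisticToContinuum.Crystallization.Theorems.FrustratedLawDichotomyCellStab16
import Summits.AtomisticToContinuum.Crystallization.Theorems.FrustratedLawDichotomyCellLinSep

/-!
# FrustratedLawDichotomy · crux `AperiodicFrustratedLawGap` (stmt-AtomisticToContinuum-27623) — class-A K-file skeleton, layer 1:
the F1 TEMPLATE FRAME (decomp-a2c hand-2 g47, structural share; KFILE-FORMAT ed2+A+B §1/§3′ + LABELS-SCALE (crit r1809))

The binding cell of the atlas: F1 = `diag(0.895, 1, 1)`-fcc at the conv-(i) scale of record, realised as the LINEAR template `a m = T·z m`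
on integer parity labels `z ∈ ℤ³`, `T = diag(10477/16384, 5853/8192, 5853/8192)` (census N9′-F1-54 `N9F1_54.json`; dials `R_A 4`,
`Rc 13`, `τ = ε = 1/1024`, `δ = 7/10`).  This file holds every F1 fact that does NOT depend on the enumerated label list (that is the
`Labels` file proper, list-backed per LABELS-SCALE (b), on lens-5's file R):
* §1 the template: `TQ` (ℚ), `T` (ℝ cast), the integer template `TZ = 2¹⁴·TQ`, its Gram form `AF1 = TZᵀTZ = diag(109767529, 137030436,
  137030436)` and the INTEGER class key `qk m = zᵀ·AF1·z` ((285)/TOY ROW 8), with the closed form;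
* §2 the admissibility predicates (Bool, kernel-friendly): `admL` (label: parity ∧ `qk ≤ BL`, `BL = 45226277715` ⇔ `(1+3ε)|Tz|² ≤ (Rc−τ)²`,
  census's 14 065 labels) and `admI` (interior: `qk ≤ BI = 4282421140` ⇔ `(1+3ε)|Tz|² ≤ R_A²`, 403 labels), their `iff` readings, the
  soundness of the two integer thresholds in `ℝ`, and the cube bound `admL ⇒ |z₀| ≤ 20 ∧ |z₁|,|z₂| ≤ 18` (membership of a COMPUTED label is
  by predicate, LABELS-SCALE rule);
* §3 the decided template facts and their `ℝ` bridges: Gershgorin rows `2/5 ≤ rowSlack(TᵀT)` ((270) pattern), `Σᵢ(T·z)ᵢ² = qk/16384²`,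
  the root at the origin, and ★ `sep_F1`: ANY two distinct parity labels are `7/10`-separated under ANY `F` of the strain cell `|FᵀF−1| ≤ ε`
  (so the K-file's `hsep` never touches the label list);
* §4 F1 under `Stab16`: `TQ·R = R·TQ` and `Rᵀ·AF1·R = AF1` decided for the sixteen elements ⇒ `qk`, `admL`, `admI` invariant, template
  equivariance `a (act m) = Rr k · a m` (the `ha` hypothesis of (272) `nn_of_reps`).
-/

namespace Summit.AtomisticToContinuum.Crystallization.Theorems.FrustratedLawDichotomyCellF1Frame

open scoped BigOperators
open Summit.AtomisticToContinuum.Crystallization.Theorems.FrustratedLawDichotomyCellMetric (posL)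
open Summit.AtomisticToContinuum.Crystallization.Theorems.FrustratedLawDichotomyCellTriples (zT sumT zT_injective two_le_sumSq_zT_sub)
open Summit.AtomisticToContinuum.Crystallization.Theorems.FrustratedLawDichotomyCellLinSep
  (rowSlack rowSlackQ rowSlack_map transpose_mul_map le_dist_of_linRadius)
open Summit.AtomisticToContinuum.Crystallization.Theorems.FrustratedLawDichotomyCellSymmZ3
  (actZ qZ sumSq_linTemplate_eq_qZ_div linTemplate_actZ)
open Summit.AtomisticToContinuum.Crystallization.Theorems.FrustratedLawDichotomyCellStab16 (RZ Rr qZ_act even_sumT_act_iff)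

/-! ## §1 The template -/

/-- F1's template matrix (rational, dyadics `2⁻¹⁴`): `diag(10477/16384, 5853/8192, 5853/8192)` (census N9′-F1-54). -/
def TQ : Matrix (Fin 3) (Fin 3) ℚ := !![10477 / 16384, 0, 0; 0, 5853 / 8192, 0; 0, 0, 5853 / 8192]

/-- its real cast: the template is `a m = T · z m`. -/
noncomputable def T : Matrix (Fin 3) (Fin 3) ℝ := TQ.map fun q : ℚ => (q : ℝ)

/-- the integer template `TZ = 2¹⁴ · TQ`. -/
def TZ : Matrix (Fin 3) (Fin 3) ℤ := !![10477, 0, 0; 0, 11706, 0; 0, 0, 11706]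

/-- its Gram form `AF1 = TZᵀ·TZ` (census `Q_form`: `q₁ = 109767529`, `q₂ = 137030436`). -/
def AF1 : Matrix (Fin 3) (Fin 3) ℤ := !![109767529, 0, 0; 0, 137030436, 0; 0, 0, 137030436]

/-- the INTEGER class key `qk m = zᵀ·AF1·z = 2²⁸·|T z|²`. -/
def qk (m : ℤ × ℤ × ℤ) : ℤ := qZ AF1 m

/-- closed form of the class key. -/
theorem qk_eq (m : ℤ × ℤ × ℤ) : qk m = 109767529 * (m.1 * m.1) + 137030436 * (m.2.1 * m.2.1 + m.2.2 * m.2.2) := by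
  simp [qk, qZ, AF1, zT, Matrix.mulVec, dotProduct, Fin.sum_univ_three]
  ring

/-- the class key is nonnegative. -/
theorem qk_nonneg (m : ℤ × ℤ × ℤ) : 0 ≤ qk m := by
  rw [qk_eq]; nlinarith [mul_self_nonneg m.1, mul_self_nonneg m.2.1, mul_self_nonneg m.2.2]

/-! ## §2 Admissibility predicates and their thresholds -/

/-- label bound: `qk ≤ BL ⇔ (1 + 3ε)·qk/2²⁸ ≤ (Rc − τ)²` (`1027·BL ≤ 13311²·2¹⁸ < 1027·(BL+1)`). -/
def BL : ℤ := 45226277715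

/-- interior bound: `qk ≤ BI ⇔ (1 + 3ε)·qk/2²⁸ ≤ R_A² = 16` (`1027·BI ≤ 2⁴² < 1027·(BI+1)`). -/
def BI : ℤ := 4282421140

/-- label admissibility (census's 14 065 labels): parity frame and the window bound. -/
def admL (m : ℤ × ℤ × ℤ) : Bool := (sumT m % 2 == 0) && decide (qk m ≤ BL)

/-- interior admissibility (census's 403 interior labels `MI`): parity frame and `‖a m‖ ≤ R_A` with the strain slack. -/
def admI (m : ℤ × ℤ × ℤ) : Bool := (sumT m % 2 == 0) && decide (qk m ≤ BI)

/-- reading of `admL`. -/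
theorem admL_iff (m : ℤ × ℤ × ℤ) : admL m = true ↔ Even (sumT m) ∧ qk m ≤ BL := by
  simp [admL, Bool.and_eq_true, beq_iff_eq, decide_eq_true_eq, Int.even_iff]

/-- reading of `admI`. -/
theorem admI_iff (m : ℤ × ℤ × ℤ) : admI m = true ↔ Even (sumT m) ∧ qk m ≤ BI := by
  simp [admI, Bool.and_eq_true, beq_iff_eq, decide_eq_true_eq, Int.even_iff]

/-- interior labels are labels. -/
theorem admL_of_admI {m : ℤ × ℤ × ℤ} (h : admI m = true) : admL m = true := by
  rw [admI_iff] at h; rw [admL_iff]; exact ⟨h.1, h.2.trans (by unfold BI BL; norm_num)⟩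

/-- the root is an interior label. -/
theorem admI_zero : admI (0, 0, 0) = true := by decide

/-- soundness of the label threshold in `ℝ`: `(1 + 3ε)·BL/2²⁸ ≤ (Rc − τ)²`. -/
theorem BL_sound : (1 + 3 * (1 / 1024 : ℝ)) * ((BL : ℝ) / 16384 ^ 2) ≤ (13 - 1 / 1024) ^ 2 := by unfold BL; norm_num

/-- soundness of the interior threshold in `ℝ`: `(1 + 3ε)·BI/2²⁸ ≤ R_A²`. -/
theorem BI_sound : (1 + 3 * (1 / 1024 : ℝ)) * ((BI : ℝ) / 16384 ^ 2) ≤ 4 ^ 2 := by unfold BI; norm_num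

/-- the cube bound: an admissible label has `|z₀| ≤ 20` and `|z₁|, |z₂| ≤ 18` (so membership of a computed label in the enumerated list is
decided by the predicate alone — LABELS-SCALE rule). -/
theorem cube_of_qk_le {m : ℤ × ℤ × ℤ} (h : qk m ≤ BL) : |m.1| ≤ 20 ∧ |m.2.1| ≤ 18 ∧ |m.2.2| ≤ 18 := by
  rw [qk_eq] at h; unfold BL at h
  have h0 := mul_self_nonneg m.1; have h1 := mul_self_nonneg m.2.1; have h2 := mul_self_nonneg m.2.2
  refine ⟨abs_le.mpr ⟨?_, ?_⟩, abs_le.mpr ⟨?_, ?_⟩, abs_le.mpr ⟨?_, ?_⟩⟩ <;> nlinarith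

/-- the cube bound for interior labels: `|zᵢ| ≤ 6`. -/
theorem cube_of_qk_le_BI {m : ℤ × ℤ × ℤ} (h : qk m ≤ BI) : |m.1| ≤ 6 ∧ |m.2.1| ≤ 5 ∧ |m.2.2| ≤ 5 := by
  rw [qk_eq] at h; unfold BI at h
  have h0 := mul_self_nonneg m.1; have h1 := mul_self_nonneg m.2.1; have h2 := mul_self_nonneg m.2.2
  refine ⟨abs_le.mpr ⟨?_, ?_⟩, abs_le.mpr ⟨?_, ?_⟩, abs_le.mpr ⟨?_, ?_⟩⟩ <;> nlinarith

/-! ## §3 Decided template facts and their real bridges -/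

/-- Gershgorin row slack of `TQᵀTQ` (decided in `ℚ`): `2/5 ≤ rowSlackQ (TQᵀTQ) i` ((270) call pattern; `λ_min = t₀² = 0.4089`). -/
theorem tq_rows : ∀ i, (2 / 5 : ℚ) ≤ rowSlackQ (TQ.transpose * TQ) i := by decide +kernel

/-- `TZ = 2¹⁴ · TQ` entrywise (decided). -/
theorem hTZ : ∀ i j, (TZ i j : ℚ) = 16384 * TQ i j := by decide +kernel

/-- `TZᵀ·TZ = AF1` (decided). -/
theorem AF1_eq : TZ.transpose * TZ = AF1 := by decide +kernel

/-- the row slack in `ℝ`. -/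
theorem t_rows : ∀ i, (2 / 5 : ℝ) ≤ rowSlack (T.transpose * T) i := by
  intro i
  have h2 : ((2 / 5 : ℚ) : ℝ) ≤ (rowSlackQ (TQ.transpose * TQ) i : ℝ) := by exact_mod_cast tq_rows i
  unfold T
  rw [transpose_mul_map, rowSlack_map]
  push_cast at h2
  exact h2

/-- ★ the template scalar per label, read off the INTEGER class key: `Σᵢ (T·z)ᵢ² = qk/16384²`. -/
theorem sumSq_T (m : ℤ × ℤ × ℤ) : ∑ i, (T.mulVec (fun j => (zT m j : ℝ)) i) ^ 2 = (qk m : ℝ) / 16384 ^ 2 := by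
  have h := sumSq_linTemplate_eq_qZ_div TQ TZ (D := 16384) (by norm_num) hTZ m
  rw [AF1_eq] at h
  unfold T qk
  rw [h]
  push_cast
  ring

/-- the window hypothesis of the doors for a label: `(1 + 3ε)·Σᵢ(T·z)ᵢ² ≤ (Rc − τ)²`. -/
theorem window_of_admL {m : ℤ × ℤ × ℤ} (h : qk m ≤ BL) :
    (1 + 3 * (1 / 1024 : ℝ)) * ∑ i, (T.mulVec (fun j => (zT m j : ℝ)) i) ^ 2 ≤ (13 - 1 / 1024) ^ 2 := by
  rw [sumSq_T]
  have h' : (qk m : ℝ) ≤ BL := by exact_mod_cast h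
  refine le_trans ?_ BL_sound
  exact mul_le_mul_of_nonneg_left (div_le_div_of_nonneg_right h' (by positivity)) (by norm_num)

/-- the interior hypothesis for an interior label: `(1 + 3ε)·Σᵢ(T·z)ᵢ² ≤ R_A²`. -/
theorem interior_of_admI {m : ℤ × ℤ × ℤ} (h : qk m ≤ BI) :
    (1 + 3 * (1 / 1024 : ℝ)) * ∑ i, (T.mulVec (fun j => (zT m j : ℝ)) i) ^ 2 ≤ 4 ^ 2 := by
  rw [sumSq_T]
  have h' : (qk m : ℝ) ≤ BI := by exact_mod_cast h
  refine le_trans ?_ BI_sound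
  exact mul_le_mul_of_nonneg_left (div_le_div_of_nonneg_right h' (by positivity)) (by norm_num)

/-- the root label sits at the origin. -/
theorem a_root : (T.mulVec fun j => (zT (0 : ℤ × ℤ × ℤ) j : ℝ)) = 0 := by
  have hz : (fun j => (zT (0 : ℤ × ℤ × ℤ) j : ℝ)) = 0 := by
    funext j; fin_cases j <;> simp [zT]
  rw [hz, Matrix.mulVec_zero]

/-- ★ SEPARATION, label-list-free: under any `F` of the strain cell `|FᵀF − 1| ≤ 1/1024`, two distinct PARITY labels are placed at distance
`≥ 7/10` by the strained template `posL F (T·z)` (Gershgorin `λ = 2/5`, `(7/10)² ≤ (1 − 3ε)·(2/5)·2`). -/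
theorem sep_F1 {F : Matrix (Fin 3) (Fin 3) ℝ} (hG : ∀ i j, |(F.transpose * F) i j - (if i = j then 1 else 0)| ≤ 1 / 1024)
    {z z' : ℤ × ℤ × ℤ} (hz : Even (sumT z)) (hz' : Even (sumT z')) (hne : z ≠ z') :
    (7 / 10 : ℝ) ≤ dist (posL F (T.mulVec fun j => (zT z j : ℝ))) (posL F (T.mulVec fun j => (zT z' j : ℝ))) :=
  le_dist_of_linRadius hG (by norm_num) T t_rows (by norm_num) (ℓ := 2) (by norm_num) (two_le_sumSq_zT_sub hz hz' hne)

/-- the list side condition from an INTEGER radius: labels at integer squared distance `≥ ℓ` are at distance `≥ L` whenever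
`L² ≤ (1 − 3ε)·(2/5)·ℓ` ((270) `le_dist_of_linRadius` specialised to F1's rows). -/
theorem le_dist_of_radius {F : Matrix (Fin 3) (Fin 3) ℝ} (hG : ∀ i j, |(F.transpose * F) i j - (if i = j then 1 else 0)| ≤ 1 / 1024)
    {z z' : ℤ × ℤ × ℤ} {L : ℝ} {ℓ : ℤ} (hL : L ^ 2 ≤ (1 - 3 * (1 / 1024)) * (2 / 5) * ℓ) (hzz : ℓ ≤ ∑ i, (zT z i - zT z' i) ^ 2) :
    L ≤ dist (posL F (T.mulVec fun j => (zT z j : ℝ))) (posL F (T.mulVec fun j => (zT z' j : ℝ))) :=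
  le_dist_of_linRadius hG (by norm_num) T t_rows (by norm_num) hL hzz

/-! ## §4 F1 under `Stab16` -/

/-- `TQ` commutes with the sixteen elements (decided in `ℚ`). -/
theorem TQ_comm : ∀ k : Fin 16, TQ * (RZ k).map (fun t : ℤ => (t : ℚ)) = (RZ k).map (fun t : ℤ => (t : ℚ)) * TQ := by
  decide +kernel

/-- `Rᵀ·AF1·R = AF1` for the sixteen elements (decided in `ℤ`). -/
theorem AF1_inv : ∀ k : Fin 16, (RZ k).transpose * AF1 * RZ k = AF1 := by decide +kernel

/-- the class key is invariant. -/
theorem qk_act (k : Fin 16) (m : ℤ × ℤ × ℤ) : qk (actZ (RZ k) m) = qk m := qZ_act k (AF1_inv k) m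

/-- label admissibility is invariant (closure of the label set BY PREDICATE). -/
theorem admL_act (k : Fin 16) (m : ℤ × ℤ × ℤ) : admL (actZ (RZ k) m) = admL m := by
  rw [Bool.eq_iff_iff, admL_iff, admL_iff, qk_act, even_sumT_act_iff]

/-- interior admissibility is invariant. -/
theorem admI_act (k : Fin 16) (m : ℤ × ℤ × ℤ) : admI (actZ (RZ k) m) = admI m := by
  rw [Bool.eq_iff_iff, admI_iff, admI_iff, qk_act, even_sumT_act_iff]

/-- template equivariance in `ℝ`: `a (act m) = Rr k · a m` (the `ha` hypothesis of (272) `nn_of_reps`). -/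
theorem a_act (k : Fin 16) (x : ℤ × ℤ × ℤ) :
    (T.mulVec fun j => (zT (actZ (RZ k) x) j : ℝ)) = (Rr k).mulVec (T.mulVec fun j => (zT x j : ℝ)) :=
  linTemplate_actZ TQ (RZ k) (TQ_comm k) x

end Summit.AtomisticToContinuum.Crystallization.Theorems.FrustratedLawDichotomyCellF1Frame
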